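import Mathlib.Tactic
import Summits.CriticalPhenomena.PercolationContinuityZ3.Theorems.PercNearOneGluingNoHeavyLowerTailSiteCovariance
import HarnessLib

/-!
# THEOREM MT: LSM-Z-2D for every multi-type de Finetti law with integer rates (site form)

Support file for the Sahi / Conjecture-P programme of route `PercNearOneGluingNoHeavy`
(`--supports stmt-CriticalPhenomena-4575`, prover prim-l12-p5 gen 31; proof notes
`prim-l12-p5/MULTITYPE-PROOF-g30.md` (statement, site model §2) and `prim-l12-p5/MULTITYPE-PROOF-g31.md`
(this proof)).  No definitions, no named facts, no sorries.

A multi-type de Finetti bi-exchangeable law with INTEGER rates is a finite family of `T` copies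
`τ` with hit probabilities `(p_τ, q_τ) ∈ [0,1]²`; its two-block cycle partition function is
`Zc(a,c) = a!·c!·[x^a y^c] ∏_τ (1 + (p_τ x + q_τ y)/(1 − x − y))`.  SITE MODEL
(MULTITYPE-PROOF-g30 Lemma 2.1): `Zc(a,c) = a!·c!·A_{a+c−1}(a,c)` where, for `m` NEUTRAL sites,
`A_m(a,c) = Σ { w(κ) : κ : Fin T ⊕ Fin m → {0,X,Y}, #X = a, #Y = c }`, the copies having weights
`(1, p_τ, q_τ)` and the neutral sites `(1, 1, 1)` for the states `(0, X, Y)`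
(`A_m(a,c) = [u^a v^c] ∏_τ (1 + p_τ u + q_τ v) (1 + u + v)^m`).

**THEOREM MT (site form, `multiType_lsm`).**  For `0 ≤ p_τ ≤ 1`, `0 ≤ q_τ` and all `a, c, n`:

  `A_{n+1}(a+1, c) · A_{n+1}(a, c+1) ≤ A_{n+2}(a+1, c+1) · A_n(a, c)`.

With `n + 1 = a + c` this is `Zc(a+1,c) Zc(a,c+1) ≤ Zc(a+1,c+1) Zc(a,c)`: LSM-Z-2D (`Zc` is TP₂) —
THEOREM MT of MULTITYPE-PROOF-g30 (= CLAIM S / (★) ≥ 0 of MULTITYPE-g29 for every number of types,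
multiplicities and anchors), hence BI-EXCH, GC-FINER and COND_TOP at every order for the integer-rate
class (FRESH-CYCLE-g24 Thm 5.2).  The present statement is STRONGER in two ways: the number of
neutral sites is free, and only `p_τ ≤ 1` is needed (`q_τ ≥ 0` arbitrary).

Proof: in the model with `n + 2` neutral sites and quotas `(a+1, c+1)` the four numbers are the
weights of {neutral `s₂` is `Y`}, {neutral `s₁` is `X`}, both, all (`remove_last`, `swap_last_two`);
the inequality is THEOREM COV (`SiteCovariance.site_covariance`: an `X`-site and a `Y`-site are
positively correlated when the `Y`-site has maximal `X`-weight — here `1 ≥ p_τ`).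

* `weight_copies` : the weight of a configuration only sees the copies;
* `card_state_succ`, `remove_last`, `swap_last_two` : reindexing lemmas;
* `multiType_lsm` : THEOREM MT.
-/

namespace Summit.CriticalPhenomena.PercolationContinuityZ3.Theorems

namespace MultiTypeLSM

open Finset

variable {T : ℕ}

/-- The weight of a configuration only sees the copy sites (neutral sites weigh `1`). -/
theorem weight_copies (p q : Fin T → ℝ) (m : ℕ) (κ : Fin T ⊕ Fin m → Fin 3) :
    (∏ s, (if κ s = 1 then Sum.elim p (fun _ => (1:ℝ)) s else if κ s = 2 then Sum.elim q (fun _ => (1:ℝ)) s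
        else 1)) =
      ∏ τ, (if κ (Sum.inl τ) = 1 then p τ else if κ (Sum.inl τ) = 2 then q τ else 1) := by
  rw [Fintype.prod_sum_type]
  have h2 : ∏ i : Fin m, (if κ (Sum.inr i) = 1 then Sum.elim p (fun _ => (1:ℝ)) (Sum.inr i)
      else if κ (Sum.inr i) = 2 then Sum.elim q (fun _ => (1:ℝ)) (Sum.inr i) else 1) = 1 :=
    Finset.prod_eq_one fun i _ => by simp
  rw [h2, mul_one]
  rfl

/-- Counting states on `Fin T ⊕ Fin (m+1)`: split off the last neutral site. -/
theorem card_state_succ (m : ℕ) (κ : Fin T ⊕ Fin (m + 1) → Fin 3) (v : Fin 3) :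
    (univ.filter (fun s => κ s = v)).card =
      (univ.filter (fun s : Fin T ⊕ Fin m => κ (Sum.map id Fin.castSucc s) = v)).card +
        (if κ (Sum.inr (Fin.last m)) = v then 1 else 0) := by
  rw [Finset.card_filter, Finset.card_filter, Fintype.sum_sum_type, Fintype.sum_sum_type,
    Fin.sum_univ_castSucc]
  simp only [Sum.map_inl, id_eq, Sum.map_inr]
  ring

/-- **Removing the last neutral site.**  Configurations on `Fin T ⊕ Fin (m+1)` whose last neutral
site is in state `v`, with quotas `(x', y')` and a further constraint on the remaining sites,
correspond to configurations on `Fin T ⊕ Fin m` with quotas `(x, y)`, `x' = x + [v = X]`,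
`y' = y + [v = Y]`, with the same weights. -/
theorem remove_last (p q : Fin T → ℝ) (m : ℕ) (v : Fin 3) (x y x' y' : ℕ)
    (hx : x' = x + (if v = 1 then 1 else 0)) (hy : y' = y + (if v = 2 then 1 else 0))
    (φ : (Fin T ⊕ Fin m → Fin 3) → Prop) [DecidablePred φ] :
    ∑ κ ∈ univ.filter (fun κ : Fin T ⊕ Fin (m + 1) → Fin 3 =>
        ((univ.filter (fun s => κ s = 1)).card = x' ∧ (univ.filter (fun s => κ s = 2)).card = y') ∧
          (κ (Sum.inr (Fin.last m)) = v ∧ φ (fun s => κ (Sum.map id Fin.castSucc s)))),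
        (∏ s, (if κ s = 1 then Sum.elim p (fun _ => (1:ℝ)) s else if κ s = 2 then Sum.elim q (fun _ => (1:ℝ)) s
          else 1)) =
      ∑ κ ∈ univ.filter (fun κ : Fin T ⊕ Fin m → Fin 3 =>
        ((univ.filter (fun s => κ s = 1)).card = x ∧ (univ.filter (fun s => κ s = 2)).card = y) ∧ φ κ),
        (∏ s, (if κ s = 1 then Sum.elim p (fun _ => (1:ℝ)) s else if κ s = 2 then Sum.elim q (fun _ => (1:ℝ)) s
          else 1)) := by
  refine Finset.sum_nbij' (fun κ s => κ (Sum.map id Fin.castSucc s))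
    (fun κ' s => Sum.elim (fun τ => κ' (Sum.inl τ)) (Fin.snoc (fun i => κ' (Sum.inr i)) v) s)
    ?_ ?_ ?_ ?_ ?_
  · intro κ hκ
    obtain ⟨⟨h1, h2⟩, hv, hφ⟩ := (Finset.mem_filter.1 hκ).2
    refine Finset.mem_filter.2 ⟨Finset.mem_univ _, ⟨?_, ?_⟩, hφ⟩
    · show (univ.filter (fun s : Fin T ⊕ Fin m => κ (Sum.map id Fin.castSucc s) = 1)).card = x
      have := card_state_succ m κ 1
      rw [h1, hv, hx] at this
      omega
    · show (univ.filter (fun s : Fin T ⊕ Fin m => κ (Sum.map id Fin.castSucc s) = 2)).card = y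
      have := card_state_succ m κ 2
      rw [h2, hv, hy] at this
      omega
  · intro κ' hκ'
    obtain ⟨⟨h1, h2⟩, hφ⟩ := (Finset.mem_filter.1 hκ').2
    have hc : ∀ s : Fin T ⊕ Fin m, Sum.elim (fun τ => κ' (Sum.inl τ))
        (Fin.snoc (fun i => κ' (Sum.inr i)) v) (Sum.map id Fin.castSucc s) = κ' s := by
      rintro (τ | i) <;> simp
    have hl : Sum.elim (fun τ => κ' (Sum.inl τ)) (Fin.snoc (fun i => κ' (Sum.inr i)) v)
        (Sum.inr (Fin.last m)) = v := by simp
    refine Finset.mem_filter.2 ⟨Finset.mem_univ _, ⟨?_, ?_⟩, hl, ?_⟩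
    · rw [card_state_succ, hx]
      simp only [hc, hl, h1]
    · rw [card_state_succ, hy]
      simp only [hc, hl, h2]
    · simp only [hc]
      exact hφ
  · intro κ hκ
    obtain ⟨_, hv, _⟩ := (Finset.mem_filter.1 hκ).2
    funext s
    rcases s with τ | i
    · simp
    · refine Fin.lastCases ?_ (fun i' => ?_) i
      · simp [hv]
      · simp
  · intro κ' _
    funext s
    rcases s with τ | i <;> simp
  · intro κ _
    rw [weight_copies, weight_copies]
    refine Finset.prod_congr rfl fun τ _ => ?_
    simp only [Sum.map_inl, id_eq]
    rfl

/-- **Exchanging the last two neutral sites** does not change a conditioned weight sum. -/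
theorem swap_last_two (p q : Fin T → ℝ) (n A C : ℕ) (v : Fin 3) :
    ∑ κ ∈ univ.filter (fun κ : Fin T ⊕ Fin (n + 2) → Fin 3 =>
        ((univ.filter (fun s => κ s = 1)).card = A ∧ (univ.filter (fun s => κ s = 2)).card = C) ∧
          κ (Sum.inr (Fin.castSucc (Fin.last n))) = v),
        (∏ s, (if κ s = 1 then Sum.elim p (fun _ => (1:ℝ)) s else if κ s = 2 then Sum.elim q (fun _ => (1:ℝ)) s
          else 1)) =
      ∑ κ ∈ univ.filter (fun κ : Fin T ⊕ Fin (n + 2) → Fin 3 =>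
        ((univ.filter (fun s => κ s = 1)).card = A ∧ (univ.filter (fun s => κ s = 2)).card = C) ∧
          κ (Sum.inr (Fin.last (n + 1))) = v),
        (∏ s, (if κ s = 1 then Sum.elim p (fun _ => (1:ℝ)) s else if κ s = 2 then Sum.elim q (fun _ => (1:ℝ)) s
          else 1)) := by
  set e : Fin T ⊕ Fin (n + 2) ≃ Fin T ⊕ Fin (n + 2) :=
    Equiv.swap (Sum.inr (Fin.castSucc (Fin.last n))) (Sum.inr (Fin.last (n + 1))) with he
  have hcard : ∀ (κ : Fin T ⊕ Fin (n + 2) → Fin 3) (w : Fin 3),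
      (univ.filter (fun s => κ (e s) = w)).card = (univ.filter (fun s => κ s = w)).card := by
    intro κ w
    rw [Finset.card_filter, Finset.card_filter]
    exact Equiv.sum_comp e (fun s => if κ s = w then 1 else 0)
  have hwt : ∀ (κ : Fin T ⊕ Fin (n + 2) → Fin 3),
      (∏ s, (if κ (e s) = 1 then Sum.elim p (fun _ => (1:ℝ)) s else if κ (e s) = 2 then
        Sum.elim q (fun _ => (1:ℝ)) s else 1)) =
      ∏ s, (if κ s = 1 then Sum.elim p (fun _ => (1:ℝ)) s else if κ s = 2 then Sum.elim q (fun _ => (1:ℝ)) s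
        else 1) := by
    intro κ
    rw [weight_copies, weight_copies]
    refine Finset.prod_congr rfl fun τ _ => ?_
    have : e (Sum.inl τ) = Sum.inl τ := by
      rw [he, Equiv.swap_apply_of_ne_of_ne] <;> simp
    rw [this]
  refine Finset.sum_nbij' (fun κ s => κ (e s)) (fun κ s => κ (e s)) ?_ ?_ ?_ ?_ ?_
  · intro κ hκ
    obtain ⟨⟨h1, h2⟩, hv⟩ := (Finset.mem_filter.1 hκ).2
    refine Finset.mem_filter.2 ⟨Finset.mem_univ _, ⟨?_, ?_⟩, ?_⟩
    · show (univ.filter (fun s => κ (e s) = 1)).card = A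
      rw [hcard, h1]
    · show (univ.filter (fun s => κ (e s) = 2)).card = C
      rw [hcard, h2]
    · show κ (e (Sum.inr (Fin.last (n + 1)))) = v
      rw [he, Equiv.swap_apply_right]; exact hv
  · intro κ hκ
    obtain ⟨⟨h1, h2⟩, hv⟩ := (Finset.mem_filter.1 hκ).2
    refine Finset.mem_filter.2 ⟨Finset.mem_univ _, ⟨?_, ?_⟩, ?_⟩
    · show (univ.filter (fun s => κ (e s) = 1)).card = A
      rw [hcard, h1]
    · show (univ.filter (fun s => κ (e s) = 2)).card = C
      rw [hcard, h2]
    · show κ (e (Sum.inr (Fin.castSucc (Fin.last n)))) = v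
      rw [he, Equiv.swap_apply_left]; exact hv
  · intro κ _
    funext s
    show κ (e (e s)) = κ s
    rw [he, Equiv.swap_apply_self]
  · intro κ _
    funext s
    show κ (e (e s)) = κ s
    rw [he, Equiv.swap_apply_self]
  · intro κ _
    beta_reduce
    exact (hwt κ).symm

/-- **THEOREM MT (site form): LSM-Z-2D for every multi-type de Finetti law with integer rates.**
For `T` copies with `0 ≤ p_τ ≤ 1`, `0 ≤ q_τ`, and `A_m(x,y)` the total weight of the configurations
of the copies and `m` neutral sites with `x` sites in state `X` and `y` in state `Y` (explicit sums
below), for all `a, c, n`: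
`A_{n+1}(a+1,c) · A_{n+1}(a,c+1) ≤ A_{n+2}(a+1,c+1) · A_n(a,c)`.
For `n + 1 = a + c` (and `Zc(x,y) = x! y! A_{x+y−1}(x,y)`): `Zc(a+1,c) Zc(a,c+1) ≤ Zc(a+1,c+1) Zc(a,c)`. -/
theorem multiType_lsm (p q : Fin T → ℝ) (hp0 : ∀ τ, 0 ≤ p τ) (hp1 : ∀ τ, p τ ≤ 1) (hq : ∀ τ, 0 ≤ q τ)
    (a c n : ℕ) :
    (∑ κ ∈ univ.filter (fun κ : Fin T ⊕ Fin (n + 1) → Fin 3 =>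
        (univ.filter (fun s => κ s = 1)).card = a + 1 ∧ (univ.filter (fun s => κ s = 2)).card = c),
        (∏ s, (if κ s = 1 then Sum.elim p (fun _ => (1:ℝ)) s else if κ s = 2 then Sum.elim q (fun _ => (1:ℝ)) s
          else 1))) *
      (∑ κ ∈ univ.filter (fun κ : Fin T ⊕ Fin (n + 1) → Fin 3 =>
        (univ.filter (fun s => κ s = 1)).card = a ∧ (univ.filter (fun s => κ s = 2)).card = c + 1),
        (∏ s, (if κ s = 1 then Sum.elim p (fun _ => (1:ℝ)) s else if κ s = 2 then Sum.elim q (fun _ => (1:ℝ)) s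
          else 1))) ≤
    (∑ κ ∈ univ.filter (fun κ : Fin T ⊕ Fin (n + 2) → Fin 3 =>
        (univ.filter (fun s => κ s = 1)).card = a + 1 ∧ (univ.filter (fun s => κ s = 2)).card = c + 1),
        (∏ s, (if κ s = 1 then Sum.elim p (fun _ => (1:ℝ)) s else if κ s = 2 then Sum.elim q (fun _ => (1:ℝ)) s
          else 1))) *
      (∑ κ ∈ univ.filter (fun κ : Fin T ⊕ Fin n → Fin 3 =>
        (univ.filter (fun s => κ s = 1)).card = a ∧ (univ.filter (fun s => κ s = 2)).card = c),
        (∏ s, (if κ s = 1 then Sum.elim p (fun _ => (1:ℝ)) s else if κ s = 2 then Sum.elim q (fun _ => (1:ℝ)) s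
          else 1))) := by
  -- THEOREM COV on `Fin T ⊕ Fin (n+2)` with the last two neutral sites
  have hP : ∀ s : Fin T ⊕ Fin (n + 2), 0 ≤ Sum.elim p (fun _ => (1:ℝ)) s := by
    rintro (τ | i); exacts [hp0 τ, zero_le_one]
  have hQ : ∀ s : Fin T ⊕ Fin (n + 2), 0 ≤ Sum.elim q (fun _ => (1:ℝ)) s := by
    rintro (τ | i); exacts [hq τ, zero_le_one]
  have hmax : ∀ s : Fin T ⊕ Fin (n + 2),
      Sum.elim p (fun _ => (1:ℝ)) s ≤ Sum.elim p (fun _ => (1:ℝ)) (Sum.inr (Fin.last (n + 1))) := by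
    rintro (τ | i); exacts [hp1 τ, le_rfl]
  have hne : (Sum.inr (Fin.castSucc (Fin.last n)) : Fin T ⊕ Fin (n + 2)) ≠ Sum.inr (Fin.last (n + 1)) := by
    simp [Fin.castSucc_ne_last]
  have COV := SiteCovariance.site_covariance (Sum.elim p (fun _ => (1:ℝ))) (Sum.elim q (fun _ => (1:ℝ)))
    hP hQ _ _ hne hmax (a + 1) (c + 1)
  -- identification of the four sums
  have h2 : ∑ κ ∈ univ.filter (fun κ : Fin T ⊕ Fin (n + 2) → Fin 3 =>
        ((univ.filter (fun s => κ s = 1)).card = a + 1 ∧ (univ.filter (fun s => κ s = 2)).card = c + 1) ∧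
          κ (Sum.inr (Fin.last (n + 1))) = 2),
        (∏ s, (if κ s = 1 then Sum.elim p (fun _ => (1:ℝ)) s else if κ s = 2 then Sum.elim q (fun _ => (1:ℝ)) s
          else 1)) =
      ∑ κ ∈ univ.filter (fun κ : Fin T ⊕ Fin (n + 1) → Fin 3 =>
        (univ.filter (fun s => κ s = 1)).card = a + 1 ∧ (univ.filter (fun s => κ s = 2)).card = c),
        (∏ s, (if κ s = 1 then Sum.elim p (fun _ => (1:ℝ)) s else if κ s = 2 then Sum.elim q (fun _ => (1:ℝ)) s
          else 1)) := by
    refine (Finset.sum_congr (Finset.filter_congr fun κ _ => ?_) fun _ _ => rfl).trans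
      ((remove_last p q (n + 1) 2 (a + 1) c (a + 1) (c + 1) (by simp) (by simp) (fun _ => True)).trans
        (Finset.sum_congr (Finset.filter_congr fun κ _ => ?_) fun _ _ => rfl))
    · simp
    · simp
  have h1 : ∑ κ ∈ univ.filter (fun κ : Fin T ⊕ Fin (n + 2) → Fin 3 =>
        ((univ.filter (fun s => κ s = 1)).card = a + 1 ∧ (univ.filter (fun s => κ s = 2)).card = c + 1) ∧
          κ (Sum.inr (Fin.castSucc (Fin.last n))) = 1),
        (∏ s, (if κ s = 1 then Sum.elim p (fun _ => (1:ℝ)) s else if κ s = 2 then Sum.elim q (fun _ => (1:ℝ)) s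
          else 1)) =
      ∑ κ ∈ univ.filter (fun κ : Fin T ⊕ Fin (n + 1) → Fin 3 =>
        (univ.filter (fun s => κ s = 1)).card = a ∧ (univ.filter (fun s => κ s = 2)).card = c + 1),
        (∏ s, (if κ s = 1 then Sum.elim p (fun _ => (1:ℝ)) s else if κ s = 2 then Sum.elim q (fun _ => (1:ℝ)) s
          else 1)) := by
    rw [swap_last_two]
    refine (Finset.sum_congr (Finset.filter_congr fun κ _ => ?_) fun _ _ => rfl).trans
      ((remove_last p q (n + 1) 1 a (c + 1) (a + 1) (c + 1) (by simp) (by simp) (fun _ => True)).trans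
        (Finset.sum_congr (Finset.filter_congr fun κ _ => ?_) fun _ _ => rfl))
    · simp
    · simp
  have h12 : ∑ κ ∈ univ.filter (fun κ : Fin T ⊕ Fin (n + 2) → Fin 3 =>
        ((univ.filter (fun s => κ s = 1)).card = a + 1 ∧ (univ.filter (fun s => κ s = 2)).card = c + 1) ∧
          (κ (Sum.inr (Fin.castSucc (Fin.last n))) = 1 ∧ κ (Sum.inr (Fin.last (n + 1))) = 2)),
        (∏ s, (if κ s = 1 then Sum.elim p (fun _ => (1:ℝ)) s else if κ s = 2 then Sum.elim q (fun _ => (1:ℝ)) s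
          else 1)) =
      ∑ κ ∈ univ.filter (fun κ : Fin T ⊕ Fin n → Fin 3 =>
        (univ.filter (fun s => κ s = 1)).card = a ∧ (univ.filter (fun s => κ s = 2)).card = c),
        (∏ s, (if κ s = 1 then Sum.elim p (fun _ => (1:ℝ)) s else if κ s = 2 then Sum.elim q (fun _ => (1:ℝ)) s
          else 1)) := by
    have r1 := remove_last p q n 1 a c (a + 1) c (by simp) (by simp) (fun _ => True)
    have r2 := remove_last p q (n + 1) 2 (a + 1) c (a + 1) (c + 1) (by simp) (by simp)
      (fun κ' => ((univ.filter (fun s => κ' s = 1)).card = a + 1 ∧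
        (univ.filter (fun s => κ' s = 2)).card = c) ∧ (κ' (Sum.inr (Fin.last n)) = 1 ∧ True))
    refine (Finset.sum_congr (Finset.filter_congr fun κ _ => ?_) fun _ _ => rfl).trans
      (r2.trans ((Finset.sum_congr (Finset.filter_congr fun κ _ => ?_) fun _ _ => rfl).trans
        (r1.trans (Finset.sum_congr (Finset.filter_congr fun κ _ => ?_) fun _ _ => rfl))))
    · simp only [Sum.map_inr, and_true]
      constructor
      · rintro ⟨hc, h1, h2⟩
        refine ⟨hc, h2, ?_, h1⟩
        have e1 := card_state_succ (n + 1) κ 1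
        have e2 := card_state_succ (n + 1) κ 2
        rw [hc.1, h2] at e1
        rw [hc.2, h2] at e2
        simp only [Fin.isValue, Fin.reduceEq, if_false, add_zero, if_true] at e1 e2
        exact ⟨e1.symm, by omega⟩
      · rintro ⟨hc, h2, _, h1⟩
        exact ⟨hc, h1, h2⟩
    · tauto
    · simp
  rw [h1, h2, h12] at COV
  linarith [COV]

/-- Relabelling the states `X ↔ Y` exchanges the roles of `(p, x)` and `(q, y)` in the site sums. -/
theorem relabel {S : Type*} [Fintype S] [DecidableEq S] (P Q : S → ℝ) (x y : ℕ) :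
    ∑ κ ∈ univ.filter (fun κ : S → Fin 3 =>
        (univ.filter (fun s => κ s = 1)).card = x ∧ (univ.filter (fun s => κ s = 2)).card = y),
        (∏ s, (if κ s = 1 then Q s else if κ s = 2 then P s else 1)) =
      ∑ κ ∈ univ.filter (fun κ : S → Fin 3 =>
        (univ.filter (fun s => κ s = 1)).card = y ∧ (univ.filter (fun s => κ s = 2)).card = x),
        (∏ s, (if κ s = 1 then P s else if κ s = 2 then Q s else 1)) := by
  have h12 : ∀ j : Fin 3, (Equiv.swap (1 : Fin 3) 2 j = 1 ↔ j = 2) ∧ (Equiv.swap (1 : Fin 3) 2 j = 2 ↔ j = 1) := by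
    decide
  refine Finset.sum_nbij' (fun κ s => Equiv.swap (1 : Fin 3) 2 (κ s)) (fun κ s => Equiv.swap (1 : Fin 3) 2 (κ s))
    ?_ ?_ ?_ ?_ ?_
  · intro κ hκ
    obtain ⟨h1, h2⟩ := (Finset.mem_filter.1 hκ).2
    refine Finset.mem_filter.2 ⟨Finset.mem_univ _, ?_, ?_⟩
    · simp only [(h12 _).1]; exact h2
    · simp only [(h12 _).2]; exact h1
  · intro κ hκ
    obtain ⟨h1, h2⟩ := (Finset.mem_filter.1 hκ).2
    refine Finset.mem_filter.2 ⟨Finset.mem_univ _, ?_, ?_⟩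
    · simp only [(h12 _).1]; exact h2
    · simp only [(h12 _).2]; exact h1
  · intro κ _; funext s; exact Equiv.swap_apply_self _ _ _
  · intro κ _; funext s; exact Equiv.swap_apply_self _ _ _
  · intro κ _
    refine Finset.prod_congr rfl fun s _ => ?_
    simp only [(h12 _).1, (h12 _).2]
    by_cases h1 : κ s = 1
    · have h2 : κ s ≠ 2 := by rw [h1]; decide
      simp [h1]
    · by_cases h2 : κ s = 2
      · simp [h2]
      · simp [h1, h2]

/-- **THEOREM MT, mirror form**: the same inequality when `q_τ ≤ 1` (and `p_τ ≥ 0` arbitrary), by the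
relabelling `X ↔ Y`, `(a, p) ↔ (c, q)`. -/
theorem multiType_lsm' (p q : Fin T → ℝ) (hp : ∀ τ, 0 ≤ p τ) (hq0 : ∀ τ, 0 ≤ q τ) (hq1 : ∀ τ, q τ ≤ 1)
    (a c n : ℕ) :
    (∑ κ ∈ univ.filter (fun κ : Fin T ⊕ Fin (n + 1) → Fin 3 =>
        (univ.filter (fun s => κ s = 1)).card = a + 1 ∧ (univ.filter (fun s => κ s = 2)).card = c),
        (∏ s, (if κ s = 1 then Sum.elim p (fun _ => (1:ℝ)) s else if κ s = 2 then Sum.elim q (fun _ => (1:ℝ)) s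
          else 1))) *
      (∑ κ ∈ univ.filter (fun κ : Fin T ⊕ Fin (n + 1) → Fin 3 =>
        (univ.filter (fun s => κ s = 1)).card = a ∧ (univ.filter (fun s => κ s = 2)).card = c + 1),
        (∏ s, (if κ s = 1 then Sum.elim p (fun _ => (1:ℝ)) s else if κ s = 2 then Sum.elim q (fun _ => (1:ℝ)) s
          else 1))) ≤
    (∑ κ ∈ univ.filter (fun κ : Fin T ⊕ Fin (n + 2) → Fin 3 =>
        (univ.filter (fun s => κ s = 1)).card = a + 1 ∧ (univ.filter (fun s => κ s = 2)).card = c + 1),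
        (∏ s, (if κ s = 1 then Sum.elim p (fun _ => (1:ℝ)) s else if κ s = 2 then Sum.elim q (fun _ => (1:ℝ)) s
          else 1))) *
      (∑ κ ∈ univ.filter (fun κ : Fin T ⊕ Fin n → Fin 3 =>
        (univ.filter (fun s => κ s = 1)).card = a ∧ (univ.filter (fun s => κ s = 2)).card = c),
        (∏ s, (if κ s = 1 then Sum.elim p (fun _ => (1:ℝ)) s else if κ s = 2 then Sum.elim q (fun _ => (1:ℝ)) s
          else 1))) := by
  have h := multiType_lsm q p hq0 hq1 hp c a n
  rw [relabel (P := (Sum.elim p (fun _ => (1:ℝ)) : Fin T ⊕ Fin (n + 1) → ℝ))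
      (Q := (Sum.elim q (fun _ => (1:ℝ)) : Fin T ⊕ Fin (n + 1) → ℝ)) (x := c + 1) (y := a),
    relabel (P := (Sum.elim p (fun _ => (1:ℝ)) : Fin T ⊕ Fin (n + 1) → ℝ))
      (Q := (Sum.elim q (fun _ => (1:ℝ)) : Fin T ⊕ Fin (n + 1) → ℝ)) (x := c) (y := a + 1),
    relabel (P := (Sum.elim p (fun _ => (1:ℝ)) : Fin T ⊕ Fin (n + 2) → ℝ))
      (Q := (Sum.elim q (fun _ => (1:ℝ)) : Fin T ⊕ Fin (n + 2) → ℝ)) (x := c + 1) (y := a + 1),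
    relabel (P := (Sum.elim p (fun _ => (1:ℝ)) : Fin T ⊕ Fin n → ℝ))
      (Q := (Sum.elim q (fun _ => (1:ℝ)) : Fin T ⊕ Fin n → ℝ)) (x := c) (y := a)] at h
  rw [mul_comm]
  exact h

end MultiTypeLSM

end Summit.CriticalPhenomena.PercolationContinuityZ3.Theorems
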